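import Mathlib
import HarnessLib
import Summits.CriticalPhenomena.CardyFormulaZ2.Theses.CardyQContinuation
import Summits.CriticalPhenomena.CardyFormulaZ2.Theorems.CardyQContinuationPivotalCancellationAtOne
import Summits.CriticalPhenomena.CardyFormulaZ2.Theorems.CardyQContinuationPivotalCancellationAtOneJets
import Summits.CriticalPhenomena.CardyFormulaZ2.Theorems.CardyQContinuationFirstJetAtOneBounded
import Summits.CriticalPhenomena.CardyFormulaZ2.Theorems.CardyQContinuationBernoulliMatch

/-!
# The two first jets of item `PivotalCancellationAtOne` (route CardyQContinuation,
stmt-CriticalPhenomena-7129) in finite volume, and the reduction to the mean pivotal count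

For a conformal rectangle `R` and mesh `δ > 0` (so that `E(Ω_δ)` is finite):

* `deriv_bernoulliJet_one`: the Bernoulli jet `P^perc′_δ(1)` of the item equals
  `Σ_{ω ⊆ E(Ω_δ)} N_piv(ω) / (4 · 2^|E(Ω_δ)|) = ¼ E_{1/2}[N_piv]` (Russo at `p = 1/2`);
* `deriv_selfDualJet_one`: the self-dual jet `P′_δ(1)` equals `¼ E_{1/2}[N_piv] + 2 Cov_{1/2}(1_C, k_B)`;
* `pivotalCancellationAtOne_of_firstJetAtOneBounded_of_tendsto_meanPivotals_atTop`: the item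
  follows from `FirstJetAtOneBounded` (stmt-CriticalPhenomena-7102) and the divergence of the mean
  number of pivotal edges `E_{1/2}[N_piv] → ∞` as `δ → 0⁺` for every conformal rectangle;
* `pivotalCancellationAtOne_of_uniformZeroFree_of_tendsto_meanPivotals_atTop`: hence (through
  `firstJetAtOneBounded_of_uniformZeroFree`, Cauchy's estimate) from the route's crux
  `UniformZeroFree` (stmt-CriticalPhenomena-5559) and the same divergence;
* `meanPivotals_eq_finsum_real_isPivotal`: the mean pivotal count is the expected number of
  pivotal edges `Σ_{e ∈ E(Ω_δ)} P_{1/2}(e pivotal for C_δ)` under `bondPercolation (zdGraph 2) half`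
  (Russo's sum form), so the divergence hypothesis is the classical `E_{1/2} N_piv → ∞`
  (`pivotalCancellationAtOne_of_firstJetAtOneBounded_of_tendsto_expectedPivotals_atTop`,
  `pivotalCancellationAtOne_of_uniformZeroFree_of_tendsto_expectedPivotals_atTop`).

So, in finite volume, the item's ratio is exactly `1 + 8 Cov_{1/2}(1_C, k_B) / E_{1/2}[N_piv]`, and the
item asserts `Cov_{1/2}(1_C, k_B) ∼ −E_{1/2}[N_piv]/8`: the research content isolated by the route's card
(q-derivative-alpha4-stress-mode). Sources: Russo 1981; Grimmett 1999 Thm. 2.25; Grimmett 2006 Thm. 3.12.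
-/

namespace Summit.CriticalPhenomena.CardyFormulaZ2.Theorems

open Filter Topology Finset

/-! ### The route's jets: `P^perc′_δ(1) = ¼ E N_piv` and `P′_δ(1) = ¼ E N_piv + 2 Cov(1_C, k_B)` -/

section Route

open Literature.Probability.LatticeModels Literature.Probability.Percolation
  Literature.Probability.RandomPlanarGeometry
  Summit.CriticalPhenomena.CardyFormulaZ2.Theses.CardyQContinuation

/-- **The Bernoulli first jet of the route is a quarter of the mean number of pivotal edges.**
For a conformal rectangle `R` and `δ > 0`, with `E = E(Ω_δ)` the (finite) edge set of the
discrete domain and `C = C_δ(Ω; (ab), (cd))` the crossing event,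
`d/dt|_{t=1} P^perc_δ(t) = (Σ_{ω ⊆ E} #{e ∈ E pivotal for C at ω}) / (4 · 2^|E|) = ¼ E_{1/2}[N_piv]`
(Russo's formula at `p = 1/2` for the exponential family `t^|ω|`, `p = t/(1+t)`). [folklore] -/
theorem deriv_bernoulliJet_one (R : ConformalRectangle) {δ : ℝ} (hδ : 0 < δ) :
    deriv (fun t : ℂ ↦ (∑ᶠ ω ∈ 𝒫 (discreteDomainGraph R.carrier δ).edgeSet,
        (discreteCrossing R.carrier δ (R.arc 0) (R.arc 2)).indicator (fun ω ↦ t ^ ω.ncard) ω) /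
        (∑ᶠ ω ∈ 𝒫 (discreteDomainGraph R.carrier δ).edgeSet, t ^ ω.ncard)) 1
      = (∑ᶠ ω ∈ 𝒫 (discreteDomainGraph R.carrier δ).edgeSet,
          ((pivotals (discreteCrossing R.carrier δ (R.arc 0) (R.arc 2)) ω
            ∩ (discreteDomainGraph R.carrier δ).edgeSet).ncard : ℂ))
        / (4 * 2 ^ (discreteDomainGraph R.carrier δ).edgeSet.ncard) := by
  classical
  obtain ⟨E, hE⟩ : ∃ E : Finset (Sym2 (Site 2)), (↑E : Set (Sym2 (Site 2)))
      = (discreteDomainGraph R.carrier δ).edgeSet :=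
    ⟨(finite_edgeSet_discreteDomainGraph R.isBounded hδ).toFinset, Set.Finite.coe_toFinset _⟩
  rw [← hE, Set.ncard_coe_finset]
  exact deriv_ratio_indicator_pow_ncard_one E (isUpperSet_discreteCrossing _ _ _ _)

/-- Norm form of `deriv_bernoulliJet_one`: `‖P^perc′_δ(1)‖ = ¼ · (mean number of pivotal edges)`,
a nonnegative real. [folklore] -/
theorem norm_deriv_bernoulliJet_one (R : ConformalRectangle) {δ : ℝ} (hδ : 0 < δ) :
    ‖deriv (fun t : ℂ ↦ (∑ᶠ ω ∈ 𝒫 (discreteDomainGraph R.carrier δ).edgeSet,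
        (discreteCrossing R.carrier δ (R.arc 0) (R.arc 2)).indicator (fun ω ↦ t ^ ω.ncard) ω) /
        (∑ᶠ ω ∈ 𝒫 (discreteDomainGraph R.carrier δ).edgeSet, t ^ ω.ncard)) 1‖
      = (∑ᶠ ω ∈ 𝒫 (discreteDomainGraph R.carrier δ).edgeSet,
          ((pivotals (discreteCrossing R.carrier δ (R.arc 0) (R.arc 2)) ω
            ∩ (discreteDomainGraph R.carrier δ).edgeSet).ncard : ℝ))
        / (4 * 2 ^ (discreteDomainGraph R.carrier δ).edgeSet.ncard) := by
  classical
  rw [deriv_bernoulliJet_one R hδ]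
  obtain ⟨E, hE⟩ : ∃ E : Finset (Sym2 (Site 2)), (↑E : Set (Sym2 (Site 2)))
      = (discreteDomainGraph R.carrier δ).edgeSet :=
    ⟨(finite_edgeSet_discreteDomainGraph R.isBounded hδ).toFinset, Set.Finite.coe_toFinset _⟩
  rw [← hE, Set.ncard_coe_finset, finsum_mem_powerset_coe_eq_sum, finsum_mem_powerset_coe_eq_sum,
    norm_div, ← Nat.cast_sum, Complex.norm_natCast, Nat.cast_sum, norm_mul, norm_pow,
    Complex.norm_ofNat, Complex.norm_ofNat]

/-- **The self-dual first jet of the route, decomposed**: for a conformal rectangle `R` and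
`δ > 0`, with `k_B(ω)` the number of open clusters of `Ω_δ` with the two discrete arcs jointly
wired, `d/ds|_{s=1} P_δ(s) = ¼ E_{1/2}[N_piv] + 2 Cov_{1/2}(1_C, k_B)` (averages over the
`2^|E|` subsets of `E(Ω_δ)`): the `|ω|`-part of the exponent `|ω| + 2k_B` contributes Russo's
pivotal term — which is exactly the Bernoulli jet `deriv_bernoulliJet_one` — and the cluster part the
covariance of the crossing indicator with the cluster count. Hence the ratio of the item
`PivotalCancellationAtOne` is `1 + 8 Cov(1_C, k_B) / E N_piv`, and the item says
`Cov_{1/2}(1_C, k_B) ∼ −E N_piv / 8` as `δ → 0⁺`. (Grimmett 2006, Thm. 3.12 at `q = 1`.) [folklore] -/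
theorem deriv_selfDualJet_one (R : ConformalRectangle) {δ : ℝ} (hδ : 0 < δ) :
    deriv (fun s : ℂ ↦ (∑ᶠ ω ∈ 𝒫 (discreteDomainGraph R.carrier δ).edgeSet,
        (discreteCrossing R.carrier δ (R.arc 0) (R.arc 2)).indicator (fun ω ↦ s ^ (ω.ncard
          + 2 * Nat.card ((openGraph ω ⊔ wired (discreteArc R.carrier δ (R.arc 0)
            ∪ discreteArc R.carrier δ (R.arc 2))).induce
              (meshDomain R.carrier δ)).ConnectedComponent)) ω) /
        (∑ᶠ ω ∈ 𝒫 (discreteDomainGraph R.carrier δ).edgeSet, s ^ (ω.ncard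
          + 2 * Nat.card ((openGraph ω ⊔ wired (discreteArc R.carrier δ (R.arc 0)
            ∪ discreteArc R.carrier δ (R.arc 2))).induce
              (meshDomain R.carrier δ)).ConnectedComponent))) 1
      = (∑ᶠ ω ∈ 𝒫 (discreteDomainGraph R.carrier δ).edgeSet,
            ((pivotals (discreteCrossing R.carrier δ (R.arc 0) (R.arc 2)) ω
              ∩ (discreteDomainGraph R.carrier δ).edgeSet).ncard : ℂ))
          / (4 * 2 ^ (discreteDomainGraph R.carrier δ).edgeSet.ncard)
        + 2 * ((∑ᶠ ω ∈ 𝒫 (discreteDomainGraph R.carrier δ).edgeSet,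
            (discreteCrossing R.carrier δ (R.arc 0) (R.arc 2)).indicator (fun ω ↦
              (Nat.card ((openGraph ω ⊔ wired (discreteArc R.carrier δ (R.arc 0)
                ∪ discreteArc R.carrier δ (R.arc 2))).induce
                  (meshDomain R.carrier δ)).ConnectedComponent : ℂ)) ω)
              / 2 ^ (discreteDomainGraph R.carrier δ).edgeSet.ncard
          - (∑ᶠ ω ∈ 𝒫 (discreteDomainGraph R.carrier δ).edgeSet,
              (discreteCrossing R.carrier δ (R.arc 0) (R.arc 2)).indicator (fun _ ↦ (1 : ℂ)) ω)
              / 2 ^ (discreteDomainGraph R.carrier δ).edgeSet.ncard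
            * ((∑ᶠ ω ∈ 𝒫 (discreteDomainGraph R.carrier δ).edgeSet,
                (Nat.card ((openGraph ω ⊔ wired (discreteArc R.carrier δ (R.arc 0)
                  ∪ discreteArc R.carrier δ (R.arc 2))).induce
                    (meshDomain R.carrier δ)).ConnectedComponent : ℂ))
                / 2 ^ (discreteDomainGraph R.carrier δ).edgeSet.ncard)) := by
  classical
  obtain ⟨E, hE⟩ : ∃ E : Finset (Sym2 (Site 2)), (↑E : Set (Sym2 (Site 2)))
      = (discreteDomainGraph R.carrier δ).edgeSet :=
    ⟨(finite_edgeSet_discreteDomainGraph R.isBounded hδ).toFinset, Set.Finite.coe_toFinset _⟩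
  rw [← hE, Set.ncard_coe_finset]
  exact deriv_ratio_indicator_pow_ncard_add_one E (isUpperSet_discreteCrossing _ _ _ _)
    (fun ω ↦ Nat.card ((openGraph ω ⊔ wired (discreteArc R.carrier δ (R.arc 0)
      ∪ discreteArc R.carrier δ (R.arc 2))).induce (meshDomain R.carrier δ)).ConnectedComponent)

/-- **Reduction of item stmt-CriticalPhenomena-7129 to item stmt-CriticalPhenomena-7102 plus
divergence of the mean number of pivotal edges.** If `FirstJetAtOneBounded` holds and, for every
conformal rectangle, the mean over `ω ⊆ E(Ω_δ)` of the number of edges of `Ω_δ` pivotal for the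
crossing `C_δ(Ω; (ab), (cd))` — i.e. `E_{1/2}[N_piv]` — tends to `+∞` as `δ → 0⁺` (on `ℤ²`:
`E N_piv ≍ δ⁻² α₄(δ, 1) → ∞`, Kesten 1987 / Garban–Pete–Schramm 2010, not in the tree for this
discretisation), then `PivotalCancellationAtOne` holds. [folklore] -/
theorem pivotalCancellationAtOne_of_firstJetAtOneBounded_of_tendsto_meanPivotals_atTop
    (hB : FirstJetAtOneBounded)
    (hdiv : ∀ R : ConformalRectangle,
      Tendsto (fun δ : ℝ ↦ (∑ᶠ ω ∈ 𝒫 (discreteDomainGraph R.carrier δ).edgeSet,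
          ((pivotals (discreteCrossing R.carrier δ (R.arc 0) (R.arc 2)) ω
            ∩ (discreteDomainGraph R.carrier δ).edgeSet).ncard : ℝ))
        / 2 ^ (discreteDomainGraph R.carrier δ).edgeSet.ncard) (𝓝[>] 0) atTop) :
    PivotalCancellationAtOne := by
  refine pivotalCancellationAtOne_of_firstJetAtOneBounded_of_tendsto_atTop hB fun R ↦ ?_
  have hev : ∀ᶠ δ : ℝ in 𝓝[>] 0, 0 < δ := eventually_mem_nhdsWithin
  refine ((hdiv R).atTop_div_const (by norm_num : (0 : ℝ) < 4)).congr' ?_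
  filter_upwards [hev] with δ hδ
  rw [norm_deriv_bernoulliJet_one R hδ]
  ring

/-- **Item stmt-CriticalPhenomena-7129 from the crux `UniformZeroFree` (stmt-CriticalPhenomena-5559)
plus divergence of the mean number of pivotal edges**: `UniformZeroFree` gives
`FirstJetAtOneBounded` by Cauchy's estimate (`firstJetAtOneBounded_of_uniformZeroFree`), and the
previous reduction applies. [folklore] -/
theorem pivotalCancellationAtOne_of_uniformZeroFree_of_tendsto_meanPivotals_atTop
    (hU : UniformZeroFree)
    (hdiv : ∀ R : ConformalRectangle,
      Tendsto (fun δ : ℝ ↦ (∑ᶠ ω ∈ 𝒫 (discreteDomainGraph R.carrier δ).edgeSet,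
          ((pivotals (discreteCrossing R.carrier δ (R.arc 0) (R.arc 2)) ω
            ∩ (discreteDomainGraph R.carrier δ).edgeSet).ncard : ℝ))
        / 2 ^ (discreteDomainGraph R.carrier δ).edgeSet.ncard) (𝓝[>] 0) atTop) :
    PivotalCancellationAtOne :=
  pivotalCancellationAtOne_of_firstJetAtOneBounded_of_tendsto_meanPivotals_atTop
    (CardyQContinuation.firstJetAtOneBounded_of_uniformZeroFree hU) hdiv

/-! ### The mean pivotal count is the expected number of pivotal edges under `P_{1/2}` -/

open scoped ProbabilityTheory in
/-- Counting → probability at `p = 1/2`: for an event `C` determined by a finite set `K ⊆ u` of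
coordinates, `(Σ_{F ⊆ K} #{e ∈ K pivotal for C at F}) / 2^|K| = Σ_{e ∈ K} setBer(u, ½){e pivotal for C}`
(each pivotality event is determined by `K`, `Russo.determinedBy_isPivotal`, and the marginal of
the product measure on `K` is uniform, `setBernoulli_half_real_eq_sum_div`). (Russo 1981 §4;
Grimmett 1999 §2.2, Thm. 2.25.) [folklore] -/
theorem sum_ncard_pivotals_div_eq_sum_real_isPivotal {ι : Type*} {u : Set ι} {K : Finset ι}
    (hK : (↑K : Set ι) ⊆ u) {C : Set (Set ι)} (hC : DeterminedBy C ↑K) :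
    (∑ F ∈ K.powerset, ((pivotals C (↑F : Set ι) ∩ ↑K).ncard : ℝ)) / 2 ^ K.card
      = ∑ e ∈ K, (setBer(u, half)).real {ω | IsPivotal C e ω} := by
  classical
  have hpiv : ∀ e ∈ K, (setBer(u, half)).real {ω | IsPivotal C e ω}
      = (∑ F ∈ K.powerset, if IsPivotal C e (↑F : Set ι) then (1 : ℝ) else 0) / 2 ^ K.card := by
    intro e _
    have hdet : DeterminedBy {ω | IsPivotal C e ω} ↑K :=
      (Russo.determinedBy_isPivotal hC e).mono (by simp)
    rw [setBernoulli_half_real_eq_sum_div hK hdet]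
    rfl
  rw [Finset.sum_congr rfl hpiv, ← Finset.sum_div, Finset.sum_comm]
  congr 1
  refine Finset.sum_congr rfl fun F _ ↦ ?_
  rw [Finset.sum_boole]
  congr 1
  rw [← Set.ncard_coe_finset]
  congr 1
  ext e
  simp [mem_pivotals, and_comm]

/-- **The mean pivotal count of the route is `E_{1/2}[N_piv]` in Russo's sum form**: for a conformal
rectangle `R` and `δ > 0`,
`(Σ_{ω ⊆ E(Ω_δ)} #{e ∈ E(Ω_δ) pivotal for C_δ at ω}) / 2^|E(Ω_δ)| = Σ_{e ∈ E(Ω_δ)} P_{1/2}(e is pivotal for C_δ)`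
under bond percolation `P_{1/2}` on `ℤ²` (`C_δ` is determined by `E(Ω_δ) ⊆ E(ℤ²)`,
`determinedBy_discreteCrossing_edgeSet`). [folklore] -/
theorem meanPivotals_eq_finsum_real_isPivotal (R : ConformalRectangle) {δ : ℝ} (hδ : 0 < δ) :
    (∑ᶠ ω ∈ 𝒫 (discreteDomainGraph R.carrier δ).edgeSet,
        ((pivotals (discreteCrossing R.carrier δ (R.arc 0) (R.arc 2)) ω
          ∩ (discreteDomainGraph R.carrier δ).edgeSet).ncard : ℝ))
        / 2 ^ (discreteDomainGraph R.carrier δ).edgeSet.ncard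
      = ∑ᶠ e ∈ (discreteDomainGraph R.carrier δ).edgeSet,
          (bondPercolation (zdGraph 2) half).real
            {ω | IsPivotal (discreteCrossing R.carrier δ (R.arc 0) (R.arc 2)) e ω} := by
  classical
  obtain ⟨K, hK⟩ : ∃ K : Finset (Sym2 (Site 2)), (↑K : Set (Sym2 (Site 2)))
      = (discreteDomainGraph R.carrier δ).edgeSet :=
    ⟨(finite_edgeSet_discreteDomainGraph R.isBounded hδ).toFinset, Set.Finite.coe_toFinset _⟩
  have hdet := determinedBy_discreteCrossing_edgeSet R.carrier δ (R.arc 0) (R.arc 2)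
  rw [← hK] at hdet ⊢
  have hKu : (↑K : Set (Sym2 (Site 2))) ⊆ (zdGraph 2).edgeSet :=
    hK ▸ SimpleGraph.edgeSet_mono
      ((discreteDomainGraph_le_meshGraph _ _).trans (meshGraph_le_zdGraph _ _))
  rw [Set.ncard_coe_finset, finsum_mem_powerset_coe_eq_sum, finsum_mem_coe_finset, bondPercolation,
    sum_ncard_pivotals_div_eq_sum_real_isPivotal hKu hdet]

/-- **Item stmt-CriticalPhenomena-7129 from item stmt-CriticalPhenomena-7102 plus `E_{1/2} N_piv → ∞`**
(expectation form of `pivotalCancellationAtOne_of_firstJetAtOneBounded_of_tendsto_meanPivotals_atTop`):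
if the first self-dual jet at `s = 1` stays bounded and, for every conformal rectangle, the expected
number `Σ_{e ∈ E(Ω_δ)} P_{1/2}(e pivotal for C_δ)` of edges pivotal for the crossing event diverges
as `δ → 0⁺` (on `ℤ²` boxes: `≍ δ⁻² α₄`, Kesten 1987; Garban–Pete–Schramm 2010), then
`PivotalCancellationAtOne`. [folklore] -/
theorem pivotalCancellationAtOne_of_firstJetAtOneBounded_of_tendsto_expectedPivotals_atTop
    (hB : FirstJetAtOneBounded)
    (hdiv : ∀ R : ConformalRectangle,
      Tendsto (fun δ : ℝ ↦ ∑ᶠ e ∈ (discreteDomainGraph R.carrier δ).edgeSet,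
          (bondPercolation (zdGraph 2) half).real
            {ω | IsPivotal (discreteCrossing R.carrier δ (R.arc 0) (R.arc 2)) e ω})
        (𝓝[>] 0) atTop) :
    PivotalCancellationAtOne := by
  refine pivotalCancellationAtOne_of_firstJetAtOneBounded_of_tendsto_meanPivotals_atTop hB
    fun R ↦ ?_
  have hev : ∀ᶠ δ : ℝ in 𝓝[>] 0, 0 < δ := eventually_mem_nhdsWithin
  refine (hdiv R).congr' ?_
  filter_upwards [hev] with δ hδ
  rw [meanPivotals_eq_finsum_real_isPivotal R hδ]

/-- **Item stmt-CriticalPhenomena-7129 from the crux `UniformZeroFree` plus `E_{1/2} N_piv → ∞`.**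
[folklore] -/
theorem pivotalCancellationAtOne_of_uniformZeroFree_of_tendsto_expectedPivotals_atTop
    (hU : UniformZeroFree)
    (hdiv : ∀ R : ConformalRectangle,
      Tendsto (fun δ : ℝ ↦ ∑ᶠ e ∈ (discreteDomainGraph R.carrier δ).edgeSet,
          (bondPercolation (zdGraph 2) half).real
            {ω | IsPivotal (discreteCrossing R.carrier δ (R.arc 0) (R.arc 2)) e ω})
        (𝓝[>] 0) atTop) :
    PivotalCancellationAtOne :=
  pivotalCancellationAtOne_of_firstJetAtOneBounded_of_tendsto_expectedPivotals_atTop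
    (CardyQContinuation.firstJetAtOneBounded_of_uniformZeroFree hU) hdiv

end Route

end Summit.CriticalPhenomena.CardyFormulaZ2.Theorems
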